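import Summits.Schanuel.Schanuel.Theorems.RigidCoreOneLogBranchRelationFiniteAlgebra

/-!
# Branch pairs of one logarithm — abstract finiteness theorem (item stmt-Schanuel-0974, part 2/3)

Support file for `RigidCore.OneLogBranchRelationFinite`. We prove the purely algebraic core
`OneLogBranch.finite_branch_pairs`:

> Let `K ⊆ E` be fields of characteristic zero, `t ∈ E` transcendental over `K`, `L ∈ E` with
> `L ∉ K + K·t`, and assume `K` is relatively algebraically closed in `E`. If `0 ≠ Q ∈ K[X₀, X₁]`
> is not divisible by `X₀ - X₁`, then `{(j, k) ∈ ℤ² : Q(L + t j, L + t k) = 0}` is finite.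

(Part 3 instantiates `K = ℚ̄`, `E = ℂ`, `L = log α`, `t = 2πi` using Baker and Hermite–Lindemann.)

Proof ("relation ideal" argument; unlike the transporter/degree proofs sketched on the card it
needs neither Bezout nor absolute irreducibility). Suppose the solution set `S` is infinite.
0. No solution is diagonal: `Q(L + tj, L + tj) = 0` makes `L + tj` algebraic over `K`, hence in
   `K`, contradicting `L ∉ K + K t` — unless `Q(X, X) ≡ 0`, i.e. `(X₀ - X₁) ∣ Q`.
1. For `(j, k) ∈ S` the sheared polynomial `σ_{j,k} Q = Q(X₀ + jX₁, X₀ + kX₁)` lies in the prime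
   ideal `𝔭 = {P : P(L, t) = 0}`, which is therefore nonzero, hence (part 1, `t` transcendental)
   generated by one irreducible `h`. So `τ_{j,k} h` (inverse shear, part 1) is an irreducible
   factor of `Q` for every solution.
2. `Q` has finitely many irreducible factors up to units: pigeonhole gives three distinct
   solutions with pairwise associated `τ_{j,k} h`; two of them, `p ≠ p'`, have non-opposite
   differences `k - j`, `k' - j'`.
3. (`orbit_step`) Associatedness means `h(x, y) = 0 ⇒ h(x + βy, γy) = 0` on `E²`, with
   `γ = (k'-j')/(k-j) ∈ ℚ ∖ {0, -1}` and `(β, γ) ≠ (0, 1)`. Iterating from `(L, t)`: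
   if `γ = 1` the zeros `(L + mβt, t)`, `m ∈ ℕ`, make `h(·, t)` vanish identically, so `t` is
   algebraic (part 1, vanishing lemma) — contradiction; if `γ ≠ ±1` the orbit is infinite on the
   line through `(u, 0)`, `u = L - βt/(γ-1)`, with direction `(β/(γ-1), 1)`, so `h` vanishes on
   that line and `u` is algebraic, i.e. `L ∈ K + K t` — contradiction.
-/

-- `Summit.Schanuel.Schanuel` (summit = problem) trips core's duplicate-namespace linter.
set_option linter.dupNamespace false

namespace Summit.Schanuel.Schanuel.Theorems.OneLogBranch

open MvPolynomial

noncomputable section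

variable {K : Type*} [Field K] [CharZero K] {E : Type*} [Field E] [CharZero E] [Algebra K E]

omit [CharZero K] [CharZero E] in
/-- Pushing a `K`-algebra map through a bivariate evaluation. -/
theorem map_aeval_eq {A B : Type*} [CommSemiring A] [CommSemiring B] [Algebra K A] [Algebra K B]
    (φ : A →ₐ[K] B) (f : Fin 2 → A) (P : MvPolynomial (Fin 2) K) :
    φ (aeval f P) = aeval ![φ (f 0), φ (f 1)] P := by
  rw [← AlgHom.comp_apply, comp_aeval]
  have hf : (fun i => φ (f i)) = ![φ (f 0), φ (f 1)] := by
    funext i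
    fin_cases i <;> simp
  rw [hf]

omit [CharZero K] [CharZero E] in
/-- **Orbit step.** If the inverse shears `τ_{j,k} h` and `τ_{j',k'} h` (part 1) are associated,
then the zero set of `h` in `E²` is stable under the affine-linear map
`(x, y) ↦ (x + β y, γ y)` with `β = (k j' - j k')/(k - j)`, `γ = (k' - j')/(k - j)`. -/
theorem orbit_step {h : MvPolynomial (Fin 2) K} {j k j' k' : K} (hjk : j ≠ k) (hjk' : j' ≠ k')
    (hass : Associated
      (aeval ![C (k - j)⁻¹ * (C k * X 0 - C j * X 1), C (k - j)⁻¹ * (X 1 - X 0)] h :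
        MvPolynomial (Fin 2) K)
      (aeval ![C (k' - j')⁻¹ * (C k' * X 0 - C j' * X 1), C (k' - j')⁻¹ * (X 1 - X 0)] h))
    (x y : E) (hxy : aeval ![x, y] h = 0) :
    aeval ![x + algebraMap K E ((k * j' - j * k') / (k - j)) * y,
      algebraMap K E ((k' - j') / (k - j)) * y] h = 0 := by
  -- the shear `σ' = σ_{j',k'}` and the inverse shear `τ = τ_{j,k}`
  set σ' : MvPolynomial (Fin 2) K →ₐ[K] MvPolynomial (Fin 2) K :=
    aeval ![X 0 + C j' * X 1, X 0 + C k' * X 1] with hσ'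
  set τ : MvPolynomial (Fin 2) K →ₐ[K] MvPolynomial (Fin 2) K :=
    aeval ![C (k - j)⁻¹ * (C k * X 0 - C j * X 1), C (k - j)⁻¹ * (X 1 - X 0)] with hτ
  obtain ⟨u, hu⟩ := hass
  have hn : (k - j) ≠ 0 := sub_ne_zero.mpr (Ne.symm hjk)
  have hn' : algebraMap K E k - algebraMap K E j ≠ 0 := by
    rw [← map_sub]
    exact (map_ne_zero _).mpr hn
  -- apply `σ'` and evaluate at `(x, y)`
  have h1 : σ' (τ h) * σ' ↑u = h := by
    rw [← map_mul, hu, hσ', shear_unshear hjk']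
  have h2 := congrArg (fun P => aeval ![x, y] P) h1
  simp only [map_mul, hxy] at h2
  have hunit : aeval ![x, y] (σ' ↑u) ≠ 0 := ((u.isUnit.map σ').map (aeval ![x, y])).ne_zero
  have h3 : aeval ![x, y] (σ' (τ h)) = 0 := by
    rcases mul_eq_zero.mp h2 with h | h
    · exact h
    · exact absurd h hunit
  rw [hσ', hτ, aeval_shear, aeval_unshear] at h3
  have e1 : algebraMap K E (k - j)⁻¹ * (algebraMap K E k * (x + algebraMap K E j' * y) -
      algebraMap K E j * (x + algebraMap K E k' * y)) =
      x + algebraMap K E ((k * j' - j * k') / (k - j)) * y := by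
    rw [map_inv₀, map_div₀, map_sub, map_sub, map_mul, map_mul]
    field_simp
    ring
  have e2 : algebraMap K E (k - j)⁻¹ * (x + algebraMap K E k' * y - (x + algebraMap K E j' * y)) =
      algebraMap K E ((k' - j') / (k - j)) * y := by
    rw [map_inv₀, map_div₀, map_sub, map_sub]
    field_simp
    ring
  rw [e1, e2] at h3
  exact h3

/-- Key contradiction: two distinct off-diagonal branch pairs `(j,k) ≠ (j',k')` with
`k' - j' ≠ -(k - j)` cannot give associated pull-backs `τ_{j,k} h ~ τ_{j',k'} h` of a
nonzero `h` vanishing at `(L, t)`, when `t` is transcendental and `L ∉ K + K t`. -/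
theorem not_associated_pair {L t : E} (hL : ∀ a c : K, algebraMap K E a + algebraMap K E c * t ≠ L)
    (ht : Transcendental K t) (hRC : ∀ u : E, IsAlgebraic K u → ∃ a : K, algebraMap K E a = u)
    {h : MvPolynomial (Fin 2) K} (hh0 : h ≠ 0) (hh : aeval ![L, t] h = 0)
    {j k j' k' : ℤ} (hjk : j ≠ k) (hjk' : j' ≠ k') (hne : (j, k) ≠ (j', k'))
    (hopp : k' - j' ≠ -(k - j))
    (hass : Associated
      (aeval ![C ((k : K) - j)⁻¹ * (C (k : K) * X 0 - C (j : K) * X 1),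
        C ((k : K) - j)⁻¹ * (X 1 - X 0)] h : MvPolynomial (Fin 2) K)
      (aeval ![C ((k' : K) - j')⁻¹ * (C (k' : K) * X 0 - C (j' : K) * X 1),
        C ((k' : K) - j')⁻¹ * (X 1 - X 0)] h)) : False := by
  have ht0 : t ≠ 0 := fun h0 => ht (h0 ▸ isAlgebraic_zero)
  have hjkK : ((j : K)) ≠ (k : K) := by exact_mod_cast hjk
  have hjkK' : ((j' : K)) ≠ (k' : K) := by exact_mod_cast hjk'
  have hnK : ((k : K) - j) ≠ 0 := sub_ne_zero.mpr (Ne.symm hjkK)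
  set β : K := ((k : K) * j' - j * k') / (k - j) with hβ
  set γ : K := ((k' : K) - j') / (k - j) with hγ
  have step : ∀ x y : E, aeval ![x, y] h = 0 →
      aeval ![x + algebraMap K E β * y, algebraMap K E γ * y] h = 0 :=
    fun x y hxy => orbit_step hjkK hjkK' hass x y hxy
  by_cases hn : k' - j' = k - j
  · -- unipotent case: `γ = 1`, `β ≠ 0`
    have hγ1 : γ = 1 := by
      rw [hγ, div_eq_one_iff_eq hnK]
      exact_mod_cast hn
    have hβ0 : β ≠ 0 := by
      intro hb
      rw [hβ, div_eq_zero_iff] at hb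
      rcases hb with hb | hb
      · apply hne
        have hb' : (k : ℤ) * j' = j * k' := by exact_mod_cast (sub_eq_zero.mp hb)
        have h1 : j = j' := by
          have : (k - j) * j' = (k - j) * j := by linear_combination hb' + j * hn
          exact (mul_left_cancel₀ (sub_ne_zero.mpr (Ne.symm hjk)) this).symm
        subst h1
        have h2 : k = k' := by linarith
        rw [h2]
      · exact hnK hb
    -- the points `(L + m β t, t)` are zeros of `h`
    have hzero : ∀ m : ℕ, aeval ![L + (m : E) * (algebraMap K E β * t), t] h = 0 := by
      intro m
      induction m with
      | zero => simpa using hh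
      | succ m ih =>
        have := step _ _ ih
        rw [hγ1, map_one, one_mul] at this
        have e : L + ((m + 1 : ℕ) : E) * (algebraMap K E β * t) =
            L + (m : E) * (algebraMap K E β * t) + algebraMap K E β * t := by
          push_cast
          ring
        rw [e]
        exact this
    have hinj : Function.Injective (fun m : ℕ => L + (m : E) * (algebraMap K E β * t)) := by
      intro m m' hmm'
      have hbt : algebraMap K E β * t ≠ 0 := mul_ne_zero ((map_ne_zero _).mpr hβ0) ht0
      have : (m : E) = m' := mul_right_cancel₀ hbt (add_left_cancel hmm')
      exact_mod_cast this
    have halg : IsAlgebraic K t :=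
      isAlgebraic_of_infinite_vanishing hh0 (Set.infinite_range_of_injective hinj)
        (by rintro _ ⟨m, rfl⟩; exact hzero m)
    exact ht halg
  · -- semisimple case: `γ ≠ 0, ±1`
    have hγ0 : γ ≠ 0 := by
      rw [hγ]; exact div_ne_zero (sub_ne_zero.mpr (Ne.symm hjkK')) hnK
    have hγ1 : γ ≠ 1 := by
      intro h1
      rw [hγ, div_eq_one_iff_eq hnK] at h1
      exact hn (by exact_mod_cast h1)
    have hγ1' : γ - 1 ≠ 0 := sub_ne_zero.mpr hγ1
    have hγE0 : algebraMap K E γ ≠ 0 := (map_ne_zero _).mpr hγ0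
    -- powers of `γ` are pairwise distinct
    have key : ∀ d : ℕ, 0 < d → (algebraMap K E γ) ^ d ≠ 1 := by
      intro d hd hd1
      have hd1' : γ ^ d = 1 := by
        apply (algebraMap K E).injective
        rw [map_pow, map_one, hd1]
      have h1 : ((k' : K) - j') ^ d = ((k : K) - j) ^ d := by
        rw [hγ, div_pow, div_eq_one_iff_eq (pow_ne_zero _ hnK)] at hd1'
        exact hd1'
      have h2 : (k' - j') ^ d = (k - j) ^ d := by exact_mod_cast h1
      rcases (pow_eq_pow_iff_of_ne_zero (Nat.pos_iff_ne_zero.mp hd)).mp h2 with h3 | ⟨h3, -⟩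
      · exact hn h3
      · exact hopp h3
    have hpow_inj : Function.Injective (fun m : ℕ => (algebraMap K E γ) ^ m) := by
      intro m m' hmm'
      simp only at hmm'
      by_contra hne'
      rcases Nat.lt_or_gt_of_ne hne' with hlt | hlt
      · apply key (m' - m) (Nat.sub_pos_of_lt hlt)
        rw [pow_sub₀ _ hγE0 hlt.le, ← hmm', mul_inv_cancel₀ (pow_ne_zero _ hγE0)]
      · apply key (m - m') (Nat.sub_pos_of_lt hlt)
        rw [pow_sub₀ _ hγE0 hlt.le, hmm', mul_inv_cancel₀ (pow_ne_zero _ hγE0)]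
    set β' : K := β / (γ - 1) with hβ'
    set u : E := L - algebraMap K E β' * t with hu
    have hβrel : algebraMap K E β = algebraMap K E β' * (algebraMap K E γ - 1) := by
      rw [← map_one (algebraMap K E), ← map_sub, ← map_mul, hβ', div_mul_cancel₀ _ hγ1']
    -- the points `(u + β' t γ^m, t γ^m)` are zeros of `h`
    have hzero : ∀ m : ℕ,
        aeval ![u + algebraMap K E β' * t * (algebraMap K E γ) ^ m, t * (algebraMap K E γ) ^ m] h
          = 0 := by
      intro m
      induction m with
      | zero =>
        have e : u + algebraMap K E β' * t * (algebraMap K E γ) ^ 0 = L := by rw [hu]; ring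
        rw [e, pow_zero, mul_one]
        exact hh
      | succ m ih =>
        have := step _ _ ih
        have e1 : u + algebraMap K E β' * t * (algebraMap K E γ) ^ (m + 1) =
            u + algebraMap K E β' * t * (algebraMap K E γ) ^ m +
              algebraMap K E β * (t * (algebraMap K E γ) ^ m) := by
          rw [hβrel]
          ring
        have e2 : t * (algebraMap K E γ) ^ (m + 1) =
            algebraMap K E γ * (t * (algebraMap K E γ) ^ m) := by ring
        rw [e1, e2]
        exact this
    -- the one-variable polynomial `s ↦ h(u + β' t s, t s)` vanishes identically
    set g : Polynomial E :=
      aeval ![Polynomial.C u + Polynomial.C (algebraMap K E β' * t) * Polynomial.X,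
        Polynomial.C t * Polynomial.X] h with hg
    have hgeval : ∀ s : E, g.eval s = aeval ![u + algebraMap K E β' * t * s, t * s] h := by
      intro s
      have : g.eval s = ((Polynomial.aeval s : Polynomial E →ₐ[E] E).restrictScalars K) g := by
        simp
      rw [this, hg, map_aeval_eq]
      simp
    have hg0 : g = 0 := by
      refine Polynomial.eq_zero_of_infinite_isRoot g
        ((Set.infinite_range_of_injective hpow_inj).mono ?_)
      rintro _ ⟨m, rfl⟩
      simp only [Set.mem_setOf_eq, Polynomial.IsRoot.def, hgeval]
      exact hzero m
    set H : MvPolynomial (Fin 2) K := aeval ![(X 1 : MvPolynomial (Fin 2) K) + C β' * X 0, X 0] h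
      with hH
    have hline : ∀ y : E, aeval ![y, u] H = 0 := by
      intro y
      have h1 : aeval ![u + algebraMap K E β' * y, y] h = 0 := by
        have := hgeval (t⁻¹ * y)
        rw [hg0, Polynomial.eval_zero, mul_assoc, mul_inv_cancel_left₀ ht0] at this
        exact this.symm
      rw [hH, map_aeval_eq]
      simpa [mul_comm] using h1
    have hH0 : H ≠ 0 := by
      intro hz
      apply hh0
      have hback : aeval ![(X 1 : MvPolynomial (Fin 2) K), X 0 - C β' * X 1] H = h := by
        rw [hH, map_aeval_eq]
        have : (![aeval ![(X 1 : MvPolynomial (Fin 2) K), X 0 - C β' * X 1]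
              (![(X 1 : MvPolynomial (Fin 2) K) + C β' * X 0, X 0] 0),
            aeval ![(X 1 : MvPolynomial (Fin 2) K), X 0 - C β' * X 1]
              (![(X 1 : MvPolynomial (Fin 2) K) + C β' * X 0, X 0] 1)] : Fin 2 → _) =
            (X : Fin 2 → MvPolynomial (Fin 2) K) := by
          funext i
          fin_cases i <;> simp
        rw [this, aeval_X_left, AlgHom.id_apply]
      rw [← hback, hz, map_zero]
    have halg : IsAlgebraic K u :=
      isAlgebraic_of_infinite_vanishing hH0 Set.infinite_univ (fun y _ => hline y)
    obtain ⟨a, ha⟩ := hRC u halg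
    exact hL a β' (by rw [ha, hu]; ring)

/-- **Abstract core.** Let `K ⊆ E` be fields of characteristic zero, `t ∈ E` transcendental over
`K`, `L ∈ E` with `L ∉ K + K·t`, and suppose every element of `E` algebraic over `K` lies in `K`.
Then for every nonzero `Q ∈ K[X₀, X₁]` not divisible by `X₀ - X₁`, only finitely many integer
pairs `(j, k)` satisfy `Q(L + t j, L + t k) = 0`. -/
theorem finite_branch_pairs {L t : E}
    (hL : ∀ a c : K, algebraMap K E a + algebraMap K E c * t ≠ L)
    (ht : Transcendental K t) (hRC : ∀ u : E, IsAlgebraic K u → ∃ a : K, algebraMap K E a = u)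
    {Q : MvPolynomial (Fin 2) K} (hQ : Q ≠ 0) (hdiv : ¬ (X 0 - X 1 : MvPolynomial (Fin 2) K) ∣ Q) :
    Set.Finite {p : ℤ × ℤ | aeval ![L + t * p.1, L + t * p.2] Q = 0} := by
  classical
  by_contra hS
  set S : Set (ℤ × ℤ) := {p : ℤ × ℤ | aeval ![L + t * p.1, L + t * p.2] Q = 0} with hSdef
  -- Step 0: no diagonal solutions
  have hoff : ∀ p ∈ S, p.1 ≠ p.2 := by
    rintro ⟨j, k⟩ hp hjk
    simp only at hjk
    subst hjk
    have hq : aeval (fun _ : Fin 2 => (X 0 : MvPolynomial (Fin 1) K)) Q ≠ 0 :=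
      fun h0 => hdiv (X_sub_X_dvd_of_aeval_diag_eq_zero h0)
    have h1 : aeval ![L + t * j] (aeval (fun _ : Fin 2 => (X 0 : MvPolynomial (Fin 1) K)) Q)
        = 0 := by
      rw [map_aeval_eq]
      simp only [hSdef, Set.mem_setOf_eq] at hp
      simpa using hp
    have halg : IsAlgebraic K (L + t * j) := by
      by_contra htr
      exact hq ((algebraicIndependent_iff.mp (algebraicIndependent_iff_transcendental.mpr htr))
        _ h1)
    obtain ⟨a, ha⟩ := hRC _ halg
    exact hL a (-(j : K)) (by rw [map_neg, map_intCast, ha]; ring)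
  -- the shears `σ j k : Q ↦ Q(X₀ + jX₁, X₀ + kX₁)` and their inverses `τ j k` (part 1)
  let σ : ℤ → ℤ → (MvPolynomial (Fin 2) K →ₐ[K] MvPolynomial (Fin 2) K) :=
    fun j k => aeval ![X 0 + C (j : K) * X 1, X 0 + C (k : K) * X 1]
  let τ : ℤ → ℤ → (MvPolynomial (Fin 2) K →ₐ[K] MvPolynomial (Fin 2) K) :=
    fun j k => aeval ![C ((k : K) - j)⁻¹ * (C (k : K) * X 0 - C (j : K) * X 1),
      C ((k : K) - j)⁻¹ * (X 1 - X 0)]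
  -- Step 1: the sheared polynomials vanish at `(L, t)`
  have hmem : ∀ p ∈ S, aeval ![L, t] (σ p.1 p.2 Q) = 0 := by
    rintro ⟨j, k⟩ hp
    simp only [σ]
    rw [aeval_shear]
    simp only [hSdef, Set.mem_setOf_eq] at hp
    simpa [mul_comm] using hp
  obtain ⟨p₀, hp₀⟩ := Set.Infinite.nonempty hS
  have hP₀ : σ p₀.1 p₀.2 Q ≠ 0 := by
    intro h0
    apply hQ
    have hjk : ((p₀.1 : K)) ≠ (p₀.2 : K) := by exact_mod_cast hoff p₀ hp₀
    simp only [σ] at h0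
    rw [← unshear_shear hjk Q, h0, map_zero]
  -- Step 2: the generator `h` of the relation ideal of `(L, t)`
  obtain ⟨h, hirr, hh, hgen⟩ := exists_irreducible_generator ht hP₀ (hmem p₀ hp₀)
  -- Step 3: each solution gives an irreducible factor `τ j k h` of `Q`
  have hτdvd : ∀ p ∈ S, τ p.1 p.2 h ∣ Q := by
    intro p hp
    have hjk : ((p.1 : K)) ≠ (p.2 : K) := by exact_mod_cast hoff p hp
    have := map_dvd (τ p.1 p.2) (hgen _ (hmem p hp))
    simp only [σ, τ] at this
    rwa [unshear_shear hjk] at this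
  have hτirr : ∀ p ∈ S, Irreducible (τ p.1 p.2 h) := by
    intro p hp
    have hjk : ((p.1 : K)) ≠ (p.2 : K) := by exact_mod_cast hoff p hp
    exact irreducible_unshear hjk hirr
  -- Step 4: pigeonhole on the finitely many irreducible factors of `Q`
  set F : Finset (MvPolynomial (Fin 2) K) := (UniqueFactorizationMonoid.factors Q).toFinset
    with hF
  set Sq : MvPolynomial (Fin 2) K → Set (ℤ × ℤ) :=
    fun q => {p ∈ S | Associated (τ p.1 p.2 h) q} with hSq
  have hcover : S ⊆ ⋃ q ∈ F, Sq q := by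
    intro p hp
    obtain ⟨q, hq, hassoc⟩ :=
      UniqueFactorizationMonoid.exists_mem_factors_of_dvd hQ (hτirr p hp) (hτdvd p hp)
    simp only [Set.mem_iUnion]
    exact ⟨q, Multiset.mem_toFinset.mpr hq, hp, hassoc⟩
  obtain ⟨q, -, hSqinf⟩ : ∃ q ∈ F, (Sq q).Infinite := by
    by_contra hcon
    push Not at hcon
    exact hS ((Set.Finite.biUnion F.finite_toSet
      (fun q hq => hcon q hq)).subset hcover)
  -- three distinct solutions with pairwise associated pull-backs
  obtain ⟨T, hTsub, hTcard⟩ := hSqinf.exists_subset_card_eq 3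
  obtain ⟨p1, p2, p3, h12, h13, h23, hT⟩ := Finset.card_eq_three.mp hTcard
  have hp1 : p1 ∈ Sq q := hTsub (by rw [hT]; simp)
  have hp2 : p2 ∈ Sq q := hTsub (by rw [hT]; simp)
  have hp3 : p3 ∈ Sq q := hTsub (by rw [hT]; simp)
  have hass : ∀ p ∈ Sq q, ∀ p' ∈ Sq q, Associated (τ p.1 p.2 h) (τ p'.1 p'.2 h) :=
    fun p hp p' hp' => hp.2.trans hp'.2.symm
  have hS' : ∀ p ∈ Sq q, p ∈ S := fun p hp => hp.1
  -- choose a pair with non-opposite differences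
  have main : ∀ p ∈ Sq q, ∀ p' ∈ Sq q, p ≠ p' → p'.2 - p'.1 ≠ -(p.2 - p.1) → False := by
    rintro ⟨j, k⟩ hp ⟨j', k'⟩ hp' hne hopp
    exact not_associated_pair hL ht hRC hirr.ne_zero hh (hoff _ (hS' _ hp)) (hoff _ (hS' _ hp'))
      hne hopp (hass _ hp _ hp')
  by_cases h12' : p2.2 - p2.1 = -(p1.2 - p1.1)
  · by_cases h13' : p3.2 - p3.1 = -(p1.2 - p1.1)
    · refine main p2 hp2 p3 hp3 h23 ?_
      rw [h12', h13', neg_neg]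
      intro h0
      have : p1.1 = p1.2 := by linarith
      exact hoff p1 (hS' _ hp1) this
    · exact main p1 hp1 p3 hp3 h13 h13'
  · exact main p1 hp1 p2 hp2 h12 h12'

end

end Summit.Schanuel.Schanuel.Theorems.OneLogBranch
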